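import Mathlib
import Summits.NavierStokesRegularity.NavierStokesRegularity.Theorems.PoloidalWindowDoorPoloidalWindowRigidityZShockSimpleWavesPencil

/-!
# Crux K2 `PoloidalWindowRigidity` (stmt-NavierStokesRegularity-19708), line `z_shock` — R3 inhabitant census: the pencil pattern lifts to an
# EXPLICIT divergence-free, e₃-poloidal field obeying the wedge law and the AUTONOMOUS slope law — every DIFFERENTIAL clause of `hGN` at once,
# on the half-space `{y + z ≠ 0}`; only entireness (hence boundedness) fails

`--supports stmt-NavierStokesRegularity-19708 --as helper` (leafhand-ns-poloidalwindowdoor-3 g24, cell decomp-ns, 2026-09-01).  Class-free,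
def-free, Mathlib + the same hand's `…ZShockSimpleWavesPencil` (certified partials of `w = (1 − x)/(y + z)`).  **No stub and no summit is
closed by this file; Navier–Stokes regularity is NOT proved here (rung 0).**

THE FIELD.  With `w = (1 − x)/(y + z)` and the structure function `Λ(s) = −s²/(1 + s²)` of `…ZShockSimpleWavesPencil`,

  `u = (u₀, u₁, u₂) := ( −½·log(1 + w²),  arctan w − w,  w )`   on `{y + z ≠ 0}`

(all components are functions of the phase `w` — as for every simple wave; `u₀ = ∂ₓφ`, `u₁ = ∂_yφ` for the potential
`φ = −(1−x)log(y+z) + (y+z)arctan w + ½(1−x)log((y+z)² + (1−x)²) + x` on `{y + z > 0}`).  Writing `σ = y + z`, the certified partials are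
`∂ₓu₀ = w/(σ(1+w²))`, `∂_yu₀ = ∂_zu₀ = w²/(σ(1+w²))`, `∂ₓu₁ = w²/(σ(1+w²))`, `∂_yu₁ = ∂_zu₁ = w³/(σ(1+w²))`, `∂ₓu₂ = −1/σ`,
`∂_yu₂ = ∂_zu₂ = −w/σ` (`hasDerivAt_pencilU0_*`, `hasDerivAt_pencilU1_*`, and `…Pencil.hasDerivAt_pencil_*`).  Hence, identically on the half-space
(each theorem bundles the existence of the partials with the identity):

* `pencilField_divFree` — `∂ₓu₀ + ∂_yu₁ + ∂_zu₂ = 0`;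
* `pencilField_poloidal` — `∂ₓu₁ − ∂_yu₀ = 0` (third vorticity component, `⟪curl u, e₃⟫ = 0`);
* `pencilField_slope` — the AUTONOMOUS slope law `∂_zu_b = Λ(w)·∂_bu₂` (`b = 0, 1`) with `Λ` a function of the value `u₂ = w` alone, so the
  wedge law `∂_zu₀∂_yu₂ − ∂_zu₁∂ₓu₂ = 0` (`pencilField_wedge`) and `hGN`'s autonomy minors (`∇Λ ∥ ∇u₂`) hold trivially;
* with `…Pencil.pencil_type / pencil_twist / pencilΛ'_ne_zero`: type `Λ(w)|∇ₕu₂|² ≤ 0` everywhere, and every point with `x ≠ 1` is at once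
  hyperbolic, genuinely nonlinear and TWISTING.

So on `{y + z > 0}` this elementary real-analytic field satisfies EVERY differential hypothesis of the class-free deciding statement `hGN`
(`…ZShockAutOfSliceLiouville`) together with all three of its point-clauses; what it lacks is exactly entireness on `ℝ³` (it is singular on
the plane `y + z = 0` through the axis of its pencil of level planes — forced for any twisting simple wave by
`…ZShockSimpleWaves.gram_eq_zero_of_levelPlanes` / `twisting_levelPlanes_false`) and boundedness.  Census consequence: `hGN` is a statement
about ENTIRE BOUNDED patterns only; no local / differential-algebraic argument (finite jets at a point, local normal forms) can prove it —
consistent with the CK-germ remark K-48 of the line card, now with a closed-form witness carrying all clauses simultaneously.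
Honest scope: kinematic, local, toy; `hGN` / R3 stay XL, not in print. [folklore]
-/

noncomputable section

namespace Summit.NavierStokesRegularity.NavierStokesRegularity.Theorems.PoloidalWindowDoorPoloidalWindowRigidityZShockSimpleWavesPencilField

-- the summit and its single sub-problem share the name (CONVENTIONS §1)
set_option linter.dupNamespace false

open Set Real
open Summit.NavierStokesRegularity.NavierStokesRegularity.Theorems.PoloidalWindowDoorPoloidalWindowRigidityZShockSimpleWavesPencil

/-! ## Partials of `u₀ = −½ log(1 + w²)` -/

/-- Chain rule for `−½·log(1 + W²)` along a line: if `W` has derivative `W'` at `t₀` then `t ↦ −½·log(1 + W t·W t)` has derivative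
`−(W t₀·W')/(1 + W t₀·W t₀)`. [folklore] -/
theorem hasDerivAt_negHalfLog {W : ℝ → ℝ} {W' t₀ : ℝ} (hW : HasDerivAt W W' t₀) :
    HasDerivAt (fun t => -(1 / 2 : ℝ) * Real.log (1 + W t * W t)) (-(W t₀ * W') / (1 + W t₀ * W t₀)) t₀ := by
  have hpos : 1 + W t₀ * W t₀ ≠ 0 := by nlinarith [mul_self_nonneg (W t₀)]
  have h1 : HasDerivAt (fun t => 1 + W t * W t) (W' * W t₀ + W t₀ * W') t₀ := (hW.mul hW).const_add 1
  have h2 := (h1.log hpos).const_mul (-(1 / 2 : ℝ))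
  refine h2.congr_deriv ?_
  field_simp
  ring

/-- Chain rule for `arctan W − W` along a line: derivative `−(W t₀·W t₀)·W'/(1 + W t₀·W t₀)`. [folklore] -/
theorem hasDerivAt_arctanSub {W : ℝ → ℝ} {W' t₀ : ℝ} (hW : HasDerivAt W W' t₀) :
    HasDerivAt (fun t => Real.arctan (W t) - W t) (-(W t₀ * W t₀) * W' / (1 + W t₀ * W t₀)) t₀ := by
  have hpos : 1 + W t₀ * W t₀ ≠ 0 := by nlinarith [mul_self_nonneg (W t₀)]
  have h2 := hW.arctan.sub hW
  refine h2.congr_deriv ?_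
  rw [sq]
  field_simp
  ring

/-- `∂ₓu₀ = w/(σ(1+w²))` for `u₀ = −½ log(1 + w²)`, `w = (1−x)/(y+z)`, `σ = y + z ≠ 0`. [folklore] -/
theorem hasDerivAt_pencilU0_x (x y z : ℝ) (h : y + z ≠ 0) :
    HasDerivAt (fun t : ℝ => -(1 / 2 : ℝ) * Real.log (1 + (1 - t) / (y + z) * ((1 - t) / (y + z))))
      ((1 - x) / (y + z) / ((y + z) * (1 + (1 - x) / (y + z) * ((1 - x) / (y + z))))) x := by
  have hW := hasDerivAt_pencil_x x y z
  refine (hasDerivAt_negHalfLog hW).congr_deriv ?_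
  have hpos : 1 + (1 - x) / (y + z) * ((1 - x) / (y + z)) ≠ 0 := by nlinarith [mul_self_nonneg ((1 - x) / (y + z))]
  field_simp

/-- `∂_yu₀ = w²/(σ(1+w²))`. [folklore] -/
theorem hasDerivAt_pencilU0_y (x y z : ℝ) (h : y + z ≠ 0) :
    HasDerivAt (fun t : ℝ => -(1 / 2 : ℝ) * Real.log (1 + (1 - x) / (t + z) * ((1 - x) / (t + z))))
      ((1 - x) / (y + z) * ((1 - x) / (y + z)) / ((y + z) * (1 + (1 - x) / (y + z) * ((1 - x) / (y + z))))) y := by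
  have hW := hasDerivAt_pencil_y x y z h
  refine (hasDerivAt_negHalfLog hW).congr_deriv ?_
  have hpos : 1 + (1 - x) / (y + z) * ((1 - x) / (y + z)) ≠ 0 := by nlinarith [mul_self_nonneg ((1 - x) / (y + z))]
  field_simp

/-- `∂_zu₀ = w²/(σ(1+w²))`. [folklore] -/
theorem hasDerivAt_pencilU0_z (x y z : ℝ) (h : y + z ≠ 0) :
    HasDerivAt (fun t : ℝ => -(1 / 2 : ℝ) * Real.log (1 + (1 - x) / (y + t) * ((1 - x) / (y + t))))
      ((1 - x) / (y + z) * ((1 - x) / (y + z)) / ((y + z) * (1 + (1 - x) / (y + z) * ((1 - x) / (y + z))))) z := by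
  have hW := hasDerivAt_pencil_z x y z h
  refine (hasDerivAt_negHalfLog hW).congr_deriv ?_
  have hpos : 1 + (1 - x) / (y + z) * ((1 - x) / (y + z)) ≠ 0 := by nlinarith [mul_self_nonneg ((1 - x) / (y + z))]
  field_simp

/-! ## Partials of `u₁ = arctan w − w` -/

/-- `∂ₓu₁ = w²/(σ(1+w²))`. [folklore] -/
theorem hasDerivAt_pencilU1_x (x y z : ℝ) (h : y + z ≠ 0) :
    HasDerivAt (fun t : ℝ => Real.arctan ((1 - t) / (y + z)) - (1 - t) / (y + z))
      ((1 - x) / (y + z) * ((1 - x) / (y + z)) / ((y + z) * (1 + (1 - x) / (y + z) * ((1 - x) / (y + z))))) x := by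
  have hW := hasDerivAt_pencil_x x y z
  refine (hasDerivAt_arctanSub hW).congr_deriv ?_
  have hpos : 1 + (1 - x) / (y + z) * ((1 - x) / (y + z)) ≠ 0 := by nlinarith [mul_self_nonneg ((1 - x) / (y + z))]
  field_simp

/-- `∂_yu₁ = w³/(σ(1+w²))`. [folklore] -/
theorem hasDerivAt_pencilU1_y (x y z : ℝ) (h : y + z ≠ 0) :
    HasDerivAt (fun t : ℝ => Real.arctan ((1 - x) / (t + z)) - (1 - x) / (t + z))
      ((1 - x) / (y + z) * ((1 - x) / (y + z)) * ((1 - x) / (y + z)) /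
        ((y + z) * (1 + (1 - x) / (y + z) * ((1 - x) / (y + z))))) y := by
  have hW := hasDerivAt_pencil_y x y z h
  refine (hasDerivAt_arctanSub hW).congr_deriv ?_
  have hpos : 1 + (1 - x) / (y + z) * ((1 - x) / (y + z)) ≠ 0 := by nlinarith [mul_self_nonneg ((1 - x) / (y + z))]
  field_simp

/-- `∂_zu₁ = w³/(σ(1+w²))`. [folklore] -/
theorem hasDerivAt_pencilU1_z (x y z : ℝ) (h : y + z ≠ 0) :
    HasDerivAt (fun t : ℝ => Real.arctan ((1 - x) / (y + t)) - (1 - x) / (y + t))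
      ((1 - x) / (y + z) * ((1 - x) / (y + z)) * ((1 - x) / (y + z)) /
        ((y + z) * (1 + (1 - x) / (y + z) * ((1 - x) / (y + z))))) z := by
  have hW := hasDerivAt_pencil_z x y z h
  refine (hasDerivAt_arctanSub hW).congr_deriv ?_
  have hpos : 1 + (1 - x) / (y + z) * ((1 - x) / (y + z)) ≠ 0 := by nlinarith [mul_self_nonneg ((1 - x) / (y + z))]
  field_simp

/-! ## The differential clauses of `hGN` on the half-space, each bundled with the existence of the partials -/

/-- ★ **Divergence-free.**  `∂ₓu₀ + ∂_yu₁ + ∂_zu₂ = 0` on `{y + z ≠ 0}`. [folklore] -/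
theorem pencilField_divFree (x y z : ℝ) (h : y + z ≠ 0) :
    ∃ d₀ d₁ d₂ : ℝ,
      HasDerivAt (fun t : ℝ => -(1 / 2 : ℝ) * Real.log (1 + (1 - t) / (y + z) * ((1 - t) / (y + z)))) d₀ x ∧
      HasDerivAt (fun t : ℝ => Real.arctan ((1 - x) / (t + z)) - (1 - x) / (t + z)) d₁ y ∧
      HasDerivAt (fun t : ℝ => (1 - x) / (y + t)) d₂ z ∧ d₀ + d₁ + d₂ = 0 := by
  refine ⟨_, _, _, hasDerivAt_pencilU0_x x y z h, hasDerivAt_pencilU1_y x y z h, hasDerivAt_pencil_z x y z h, ?_⟩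
  have hpos : 1 + (1 - x) / (y + z) * ((1 - x) / (y + z)) ≠ 0 := by nlinarith [mul_self_nonneg ((1 - x) / (y + z))]
  field_simp
  ring

/-- ★ **Poloidal along `e₃`.**  `∂ₓu₁ − ∂_yu₀ = 0` (the third component of `curl u` vanishes) on `{y + z ≠ 0}`. [folklore] -/
theorem pencilField_poloidal (x y z : ℝ) (h : y + z ≠ 0) :
    ∃ a b : ℝ,
      HasDerivAt (fun t : ℝ => Real.arctan ((1 - t) / (y + z)) - (1 - t) / (y + z)) a x ∧
      HasDerivAt (fun t : ℝ => -(1 / 2 : ℝ) * Real.log (1 + (1 - x) / (t + z) * ((1 - x) / (t + z)))) b y ∧ a - b = 0 :=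
  ⟨_, _, hasDerivAt_pencilU1_x x y z h, hasDerivAt_pencilU0_y x y z h, by ring⟩

/-- ★ **Autonomous slope law.**  `∂_zu₀ = Λ(w)·∂ₓu₂` and `∂_zu₁ = Λ(w)·∂_yu₂` with `Λ(s) = −s²/(1+s²)` a function of the VALUE `u₂ = w`
alone — (TH)/thick typing: `Λ' ≠ 0` off `w = 0` (`…Pencil.pencilΛ'_ne_zero`), i.e. THICK; `hGN`'s autonomy minors `∇Λ ∥ ∇u₂` hold
trivially. [folklore] -/
theorem pencilField_slope (x y z : ℝ) (h : y + z ≠ 0) :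
    let w := (1 - x) / (y + z)
    ∃ c₀ c₁ p₀ p₁ : ℝ,
      HasDerivAt (fun t : ℝ => -(1 / 2 : ℝ) * Real.log (1 + (1 - x) / (y + t) * ((1 - x) / (y + t)))) c₀ z ∧
      HasDerivAt (fun t : ℝ => Real.arctan ((1 - x) / (y + t)) - (1 - x) / (y + t)) c₁ z ∧
      HasDerivAt (fun t : ℝ => (1 - t) / (y + z)) p₀ x ∧
      HasDerivAt (fun t : ℝ => (1 - x) / (t + z)) p₁ y ∧
      c₀ = (-(w * w) / (1 + w * w)) * p₀ ∧ c₁ = (-(w * w) / (1 + w * w)) * p₁ := by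
  intro w
  refine ⟨_, _, _, _, hasDerivAt_pencilU0_z x y z h, hasDerivAt_pencilU1_z x y z h, hasDerivAt_pencil_x x y z,
    hasDerivAt_pencil_y x y z h, ?_, ?_⟩
  · have hpos : 1 + (1 - x) / (y + z) * ((1 - x) / (y + z)) ≠ 0 := by nlinarith [mul_self_nonneg ((1 - x) / (y + z))]
    show _ = (-((1 - x) / (y + z) * ((1 - x) / (y + z))) / (1 + (1 - x) / (y + z) * ((1 - x) / (y + z)))) * (-1 / (y + z))
    field_simp
  · have hpos : 1 + (1 - x) / (y + z) * ((1 - x) / (y + z)) ≠ 0 := by nlinarith [mul_self_nonneg ((1 - x) / (y + z))]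
    show _ = (-((1 - x) / (y + z) * ((1 - x) / (y + z))) / (1 + (1 - x) / (y + z) * ((1 - x) / (y + z)))) *
      (-(1 - x) / (y + z) ^ 2)
    field_simp

/-- **Wedge law** (frozen slope law of the class, `∂_zuₕ ∥ ∇ₕu₂`): `∂_zu₀·∂_yu₂ − ∂_zu₁·∂ₓu₂ = 0` on `{y + z ≠ 0}`. [folklore] -/
theorem pencilField_wedge (x y z : ℝ) (h : y + z ≠ 0) :
    ∃ c₀ c₁ p₀ p₁ : ℝ,
      HasDerivAt (fun t : ℝ => -(1 / 2 : ℝ) * Real.log (1 + (1 - x) / (y + t) * ((1 - x) / (y + t)))) c₀ z ∧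
      HasDerivAt (fun t : ℝ => Real.arctan ((1 - x) / (y + t)) - (1 - x) / (y + t)) c₁ z ∧
      HasDerivAt (fun t : ℝ => (1 - t) / (y + z)) p₀ x ∧
      HasDerivAt (fun t : ℝ => (1 - x) / (t + z)) p₁ y ∧ c₀ * p₁ - c₁ * p₀ = 0 := by
  obtain ⟨c₀, c₁, p₀, p₁, h₀, h₁, h₂, h₃, e₀, e₁⟩ := pencilField_slope x y z h
  exact ⟨c₀, c₁, p₀, p₁, h₀, h₁, h₂, h₃, by rw [e₀, e₁]; ring⟩

/-! ## Appended (same hand): the SIMPLE-WAVE DICTIONARY — for phase fields `u = U(w)`, incompressibility IS the null condition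

Why the pencil field works, in general.  For a simple wave `w` (`∂ᵢw = −nᵢ(w)/D`, `…ZShockSimpleWaves`) every field built from the phase,
`u = (U₀(w), U₁(w), w)`, has partials `∂ᵢu_b = U_b'(w)·∂ᵢw`.  Impose the slope law in the form `U_b' = Λ·n_b/n₂` (`b = 0, 1`, `n₂ ≠ 0`).
Then, pointwise and for ANY normal curve: the slope law `∂_zu_b = Λ(w)∂_bu₂` holds (`simpleWaveField_slope`), poloidality
`∂ₓu₁ − ∂_yu₀ = 0` is AUTOMATIC (`simpleWaveField_poloidal`), the divergence is `−(n₂² + Λ(n₀² + n₁²))/(n₂D)` (`simpleWaveField_div`), so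
`div u = 0 ⟺ NULL CONDITION` (`simpleWaveField_divFree_iff_null`), and the type is `Λ|∇ₕu₂|² = −(n₂/D)² ≤ 0` (`simpleWaveField_type`).
Hence EVERY analytic normal curve `s ↦ (n₀, n₁, n₂)(s)` with `n₂ ≠ 0` and turning horizontal part yields — with `Λ := −n₂²/(n₀² + n₁²)`
DEFINED by the curve and `U_b := ∫Λn_b/n₂` — a local field satisfying every differential clause of `hGN` with hyperbolic, twisting and
(generically) genuinely nonlinear points; the pencils above are the members `n = (1, s, s)` and `n = (1, s, 1)`.  The one-family sector of
the class-free statement is thus as large as «analytic space curves», and is excluded by entireness alone. -/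

section SimpleWaveDictionary

/-- **Divergence of a phase field.**  With `wᵢ = −nᵢ/D`, `∂ᵢu_b = U_b'·wᵢ`, `U_b' = Λn_b/n₂` (`b = 0,1`) and `u₂ = w`:
`div u = U₀'w₀ + U₁'w₁ + w₂ = −(n₂² + Λ(n₀² + n₁²))/(n₂D)`. [folklore] -/
theorem simpleWaveField_div {n₀ n₁ n₂ D Λ w₀ w₁ w₂ U₀' U₁' : ℝ} (hn₂ : n₂ ≠ 0) (hD : D ≠ 0)
    (hw₀ : w₀ = -n₀ / D) (hw₁ : w₁ = -n₁ / D) (hw₂ : w₂ = -n₂ / D)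
    (hU₀ : U₀' = Λ * n₀ / n₂) (hU₁ : U₁' = Λ * n₁ / n₂) :
    U₀' * w₀ + U₁' * w₁ + w₂ = -(n₂ * n₂ + Λ * (n₀ * n₀ + n₁ * n₁)) / (n₂ * D) := by
  subst hw₀ hw₁ hw₂ hU₀ hU₁
  field_simp
  ring

/-- ★ **Incompressibility ⟺ null condition** for phase fields with the slope law built in. [folklore] -/
theorem simpleWaveField_divFree_iff_null {n₀ n₁ n₂ D Λ w₀ w₁ w₂ U₀' U₁' : ℝ} (hn₂ : n₂ ≠ 0) (hD : D ≠ 0)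
    (hw₀ : w₀ = -n₀ / D) (hw₁ : w₁ = -n₁ / D) (hw₂ : w₂ = -n₂ / D)
    (hU₀ : U₀' = Λ * n₀ / n₂) (hU₁ : U₁' = Λ * n₁ / n₂) :
    U₀' * w₀ + U₁' * w₁ + w₂ = 0 ↔ n₂ * n₂ + Λ * (n₀ * n₀ + n₁ * n₁) = 0 := by
  rw [simpleWaveField_div hn₂ hD hw₀ hw₁ hw₂ hU₀ hU₁, div_eq_zero_iff, neg_eq_zero]
  have : n₂ * D ≠ 0 := mul_ne_zero hn₂ hD
  constructor
  · rintro (h | h)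
    · exact h
    · exact absurd h this
  · intro h; exact Or.inl h

/-- **Poloidality is automatic** for phase fields with the slope law built in: `∂ₓu₁ − ∂_yu₀ = U₁'w₀ − U₀'w₁ = 0`. [folklore] -/
theorem simpleWaveField_poloidal {n₀ n₁ n₂ D Λ w₀ w₁ U₀' U₁' : ℝ}
    (hw₀ : w₀ = -n₀ / D) (hw₁ : w₁ = -n₁ / D)
    (hU₀ : U₀' = Λ * n₀ / n₂) (hU₁ : U₁' = Λ * n₁ / n₂) :
    U₁' * w₀ - U₀' * w₁ = 0 := by
  subst hw₀ hw₁ hU₀ hU₁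
  ring

/-- **The slope law** `∂_zu_b = Λ·∂_bu₂` (`b = 0, 1`) holds by construction: `U_b'·w₂ = Λ·w_b`. [folklore] -/
theorem simpleWaveField_slope {n₀ n₁ n₂ D Λ w₀ w₁ w₂ U₀' U₁' : ℝ} (hn₂ : n₂ ≠ 0)
    (hw₀ : w₀ = -n₀ / D) (hw₁ : w₁ = -n₁ / D) (hw₂ : w₂ = -n₂ / D)
    (hU₀ : U₀' = Λ * n₀ / n₂) (hU₁ : U₁' = Λ * n₁ / n₂) :
    U₀' * w₂ = Λ * w₀ ∧ U₁' * w₂ = Λ * w₁ := by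
  subst hw₀ hw₁ hw₂ hU₀ hU₁
  constructor <;> field_simp

/-- **Type of a null phase field:** `Λ|∇ₕu₂|² = −(n₂/D)² ≤ 0` — no elliptic point, hyperbolic wherever `n₂ ≠ 0`. [folklore] -/
theorem simpleWaveField_type {n₀ n₁ n₂ D Λ w₀ w₁ : ℝ} (hD : D ≠ 0)
    (hw₀ : w₀ = -n₀ / D) (hw₁ : w₁ = -n₁ / D) (hnull : n₂ * n₂ + Λ * (n₀ * n₀ + n₁ * n₁) = 0) :
    Λ * (w₀ * w₀ + w₁ * w₁) = -(n₂ / D) ^ 2 := by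
  subst hw₀ hw₁
  field_simp
  linear_combination hnull

end SimpleWaveDictionary

/-! ## Appended (same hand): the OBLIQUE pencil field — strictly hyperbolic AND twisting at EVERY point

The dictionary applied to the second pencil of `…ZShockSimpleWavesPencil` (`w = (1 − x − z)/y`, `n(s) = (1, s, 1)`, `Λ(s) = −1/(1+s²)`):
`U₀' = Λn₀/n₂ = −1/(1+s²)`, `U₁' = Λn₁/n₂ = −s/(1+s²)`, i.e. the explicit field

  `u = ( −arctan w,  −½·log(1 + w²),  w )`,  `w = (1 − x − z)/y`,  on `{y ≠ 0}`,

with certified partials `∂ₓu₀ = ∂_zu₀ = 1/(y(1+w²))`, `∂_yu₀ = w/(y(1+w²))`, `∂ₓu₁ = ∂_zu₁ = w/(y(1+w²))`, `∂_yu₁ = w²/(y(1+w²))`,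
`∂ₓu₂ = ∂_zu₂ = −1/y`, `∂_yu₂ = −w/y`.  It is divergence-free, e₃-poloidal and obeys the autonomous slope law (below), its type is `−1/y² < 0` and
its twisting minor `1/y³ ≠ 0` at EVERY point (`…Pencil.oblique_type`, `oblique_twist`), and it is genuinely nonlinear off `x + z = 1`: an
everywhere-hyperbolic, everywhere-twisting local inhabitant of all differential clauses of `hGN`. -/

section ObliqueField

/-- Chain rule for `−arctan W` along a line: derivative `−W'/(1 + W t₀·W t₀)`. [folklore] -/
theorem hasDerivAt_negArctan {W : ℝ → ℝ} {W' t₀ : ℝ} (hW : HasDerivAt W W' t₀) :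
    HasDerivAt (fun t => -Real.arctan (W t)) (-W' / (1 + W t₀ * W t₀)) t₀ := by
  have hpos : 1 + W t₀ * W t₀ ≠ 0 := by nlinarith [mul_self_nonneg (W t₀)]
  refine hW.arctan.neg.congr_deriv ?_
  rw [sq]
  field_simp

/-- ★ **The oblique pencil field: divergence-free, poloidal, autonomous slope law — with certified partials.**  On `{y ≠ 0}`, for
`u = (−arctan w, −½log(1+w²), w)`, `w = (1−x−z)/y`: `∂ₓu₀ + ∂_yu₁ + ∂_zu₂ = 0`, `∂ₓu₁ − ∂_yu₀ = 0`, and `∂_zu_b = Λ(w)·∂_bu₂` (`b = 0,1`) with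
`Λ(w) = −1/(1 + w²)`. [folklore] -/
theorem obliqueField_clauses (x y z : ℝ) (h : y ≠ 0) :
    let w := (1 - x - z) / y
    ∃ a₀ b₀ c₀ a₁ b₁ c₁ p₀ p₁ p₂ : ℝ,
      HasDerivAt (fun t : ℝ => -Real.arctan ((1 - t - z) / y)) a₀ x ∧
      HasDerivAt (fun t : ℝ => -Real.arctan ((1 - x - z) / t)) b₀ y ∧
      HasDerivAt (fun t : ℝ => -Real.arctan ((1 - x - t) / y)) c₀ z ∧
      HasDerivAt (fun t : ℝ => -(1 / 2 : ℝ) * Real.log (1 + (1 - t - z) / y * ((1 - t - z) / y))) a₁ x ∧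
      HasDerivAt (fun t : ℝ => -(1 / 2 : ℝ) * Real.log (1 + (1 - x - z) / t * ((1 - x - z) / t))) b₁ y ∧
      HasDerivAt (fun t : ℝ => -(1 / 2 : ℝ) * Real.log (1 + (1 - x - t) / y * ((1 - x - t) / y))) c₁ z ∧
      HasDerivAt (fun t : ℝ => (1 - t - z) / y) p₀ x ∧
      HasDerivAt (fun t : ℝ => (1 - x - z) / t) p₁ y ∧
      HasDerivAt (fun t : ℝ => (1 - x - t) / y) p₂ z ∧
      a₀ + b₁ + p₂ = 0 ∧ a₁ - b₀ = 0 ∧ c₀ = (-1 / (1 + w * w)) * p₀ ∧ c₁ = (-1 / (1 + w * w)) * p₁ := by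
  intro w
  have hpx := hasDerivAt_oblique_x x y z
  have hpy := hasDerivAt_oblique_y x y z h
  have hpz := hasDerivAt_oblique_z x y z
  refine ⟨_, _, _, _, _, _, _, _, _, hasDerivAt_negArctan hpx, hasDerivAt_negArctan hpy, hasDerivAt_negArctan hpz,
    hasDerivAt_negHalfLog hpx, hasDerivAt_negHalfLog hpy, hasDerivAt_negHalfLog hpz, hpx, hpy, hpz, ?_, ?_, ?_, ?_⟩
  all_goals
    have hw : w = (1 - x - z) / y := rfl
    have h1 : 1 + (1 - x - z) / y * ((1 - x - z) / y) ≠ 0 := by nlinarith [mul_self_nonneg ((1 - x - z) / y)]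
  · field_simp
    ring
  · field_simp
    ring
  · rw [hw]
    field_simp
  · rw [hw]
    field_simp

end ObliqueField


end Summit.NavierStokesRegularity.NavierStokesRegularity.Theorems.PoloidalWindowDoorPoloidalWindowRigidityZShockSimpleWavesPencilField
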